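import Summits.ResolutionOfSingularities.ResolutionOfSingularities.Theorems.EquisingularLiftEquisingularLiftNatFirstOrderLinePoints
import HarnessLib

/-!
# Crux `EquisingularLift` (stmt-ResolutionOfSingularities-15660): the OPEN residual `stub_blowupModel_ge_five` holds for every hypersurface whose singular
# locus is a ONE-STEP / FIRST-ORDER coordinate `ℙʳ` — every field, every dimension

[OURS · leafhand-res-equisingularlift-9 g0, 2026-08-31; cell `pub/decomp-res`] AI-produced, weaker than expert review; NOT a statement of any manuscript;
nothing here proves resolution of singularities in positive characteristic.  DEF-FREE helper, `--supports stmt-…-15660`; standard axioms; ZERO named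
hypotheses.

The DOWNSTAIRS content of seat res-D-pv-013's T-ONESTEP-LINE ✓ `OneStepLine.elNatAt_oneStepLine` — «every blow-up of `H = V₊(F)` along `Λ·𝒪_H`,
`Λ = ker Proj(f)` the coordinate `ℙʳ`, is regular» — proved there inline on the way to `ELNatAt`, recorded here as a theorem of its own over ANY field
and read in the currency of crux 15660 («`∃ 𝔞 ≠ ⊥` on `H` all of whose blow-ups are regular»), for one-step lines and for this hand's first-order lines
(✓ `FirstOrderLine.exists_strictTransform`):

* `OneStepLine.isRegular_of_isBlowup_comap` — the downstairs regularity (verbatim the last block of ✓ `OneStepLine.elNatAt_oneStepLine`);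
* `OneStepLine.comap_ne_bot` — `Λ·𝒪_H ≠ ⊥` (`H ⊄ L`);
* ★ `StrataSplit.blowupModel_oneStepLine`, ★ `StrataSplit.blowupModel_firstOrderLine` — regular blow-up models for `V₊(F)` with a one-step / first-order
  coordinate `ℙʳ` as singular locus: instances of the conclusion of `stub_blowupModel_ge_five` in every characteristic and dimension (e.g. surfaces of any
  degree with a first-order double line; pinch points allowed).

Honest label: no registered stub closed; `stub_blowupModel_ge_five` stays OPEN.

References: [Hartshorne1977, II Prop. 5.9, II Ex. 7.12]; [StacksProject, Tags 0804, 02OS]; [Matsumura1987, Thm. 14.2] — through the cited tree files.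
-/

set_option linter.dupNamespace false -- mandated namespace `Summit.<Summit>.<Problem>` of this single-conjunct summit

noncomputable section

open CategoryTheory CategoryTheory.Limits AlgebraicGeometry TopologicalSpace
open MvPolynomial HomogeneousLocalization
open Literature.AlgebraicGeometry.Resolution
open Literature.AlgebraicGeometry.Motives Literature.AlgebraicGeometry.Motives.SmoothHypersurface
open Literature.AlgebraicGeometry.Motives.ProjectiveSpace
open AlgebraicGeometry.Scheme.IdealSheafData
open Summit.ResolutionOfSingularities.ResolutionOfSingularities.Cruxes.EquisingularLift.StrataSplit

namespace Summit.ResolutionOfSingularities.ResolutionOfSingularities.Cruxes.EquisingularLiftNat.Sections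

namespace OneStepLine

variable (K : Type) [Field K] {m : ℕ} (F : MvPolynomial (Fin (m + 2 + 1)) K) {d : ℕ} (hF : F.IsHomogeneous d) (hFp : Prime F)
  {r : ℕ} (e : Fin (r + 1) → Fin (m + 2 + 1)) (he : Function.Injective e)

include hFp he in
/-- **DOWNSTAIRS, over any field: every blow-up of `H = V₊(F)` along `Λ·𝒪_H` (`Λ` the coordinate `ℙʳ` of the surviving coordinates `e`) is regular**
when the charts off `L = V(Λ)` are regular and every chart `c ∈ range e` carries one-step splitting data (as in ✓ `OneStepLine.elNatAt_oneStepLine`).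
Verbatim the downstairs block of that theorem. [cite: StacksProject, Tag 0804] [cite: Matsumura1987, Thm. 14.2] -/
theorem isRegular_of_isBlowup_comap
    (hone : ∀ c ∈ Set.range e, ∃ (M : ℕ) (R : Type) (_ : CommRing R) (_ : IsDomain R)
      (ρ : MvPolynomial (Fin (m + 2)) K ≃+* MvPolynomial (Fin (M + 1)) R),
      (∀ j : Fin (m + 2), c.succAbove j ∉ Set.range e → ∃ i : Fin (M + 1), ρ (X j) = X i) ∧
      (∀ i : Fin (M + 1), ∃ j : Fin (m + 2), c.succAbove j ∉ Set.range e ∧ ρ (X j) = X i) ∧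
      ∃ (Φ Ψ : MvPolynomial (Fin (M + 1)) R) (μ : ℕ), Φ.IsHomogeneous μ ∧ Φ ≠ 0 ∧
        Ψ ∈ Ideal.span (Set.range (X : Fin (M + 1) → MvPolynomial (Fin (M + 1)) R)) ^ (μ + 1) ∧
        ρ (ProjectiveSpace.dehomogenize K c F) = Φ + Ψ ∧
        (Ideal.span {ProjectiveSpace.dehomogenize K c F}).radical = Ideal.span {ProjectiveSpace.dehomogenize K c F} ∧
        ∀ l : Fin (M + 1), ∃ G : MvPolynomial (Fin (M + 1)) R,
          aeval (fun j => X l * Function.update (X : Fin (M + 1) → MvPolynomial (Fin (M + 1)) R) l 1 j) (Φ + Ψ) = X l ^ μ * G ∧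
          ∀ (P : Ideal (MvPolynomial (Fin (M + 1)) R ⧸ Ideal.span {G})) [P.IsPrime],
            Ideal.Quotient.mk (Ideal.span {G}) (X l) ∈ P → IsRegularLocalRing (Localization.AtPrime P)) :
    letI := MvPolynomial.gradedAlgebra (σ := Fin (m + 2 + 1)) (R := K)
    letI := MvPolynomial.gradedAlgebra (σ := Fin (r + 1)) (R := K)
    ∀ (_hoff : ∀ c, c ∉ Set.range e → IsRegularRing (ChartRing F c hF))
      (fk : homogeneousSubmodule (Fin (m + 2 + 1)) K →+*ᵍ homogeneousSubmodule (Fin (r + 1)) K)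
      (hfk' : HomogeneousIdeal.irrelevant (homogeneousSubmodule (Fin (r + 1)) K) ≤
        (HomogeneousIdeal.irrelevant (homogeneousSubmodule (Fin (m + 2 + 1)) K)).map fk)
      (_hfkC : ∀ a : K, fk (C a) = C a) (_hfke : ∀ j : Fin (r + 1), fk (X (e j)) = X j)
      (_hfk0 : ∀ i : Fin (m + 2 + 1), i ∉ Set.range e → fk (X i) = 0)
      (Z : Scheme.{0}) (π : Z ⟶ (hypersurface F).left),
      IsBlowup π (((Proj.map fk hfk').ker).comap (hypersurfaceι F).left) → Scheme.IsRegular Z := by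
  letI := MvPolynomial.gradedAlgebra (σ := Fin (m + 2 + 1)) (R := K)
  letI := MvPolynomial.gradedAlgebra (σ := Fin (r + 1)) (R := K)
  intro hoff fk hfk' hfkC hfke hfk0 Z π hπ
  classical
  have hd : 0 < d := ConeN.pos_of_prime_of_isHomogeneous K F hF hFp
  intro z
  by_cases hzs : π z ∈ ((((Proj.map fk hfk').ker).comap (hypersurfaceι F).left).support : Set (hypersurface F).left)
  · -- over the centre: the chart of a one-step linear centre
    refine HypersurfaceSpecimen.isRegularLocalRing_stalk_of_isBlowup_comap_of_mem_support K F hF hd e he fk hfk' hfkC hfke hfk0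
      (fun c hc a 𝔐 _ h𝔐 => ?_) hπ z hzs
    obtain ⟨M, R, _, _, ρ', hρ₁, hρ₂, Φ, Ψ, μ, hΦ, hΦ0, hΨ, hρf, hrad, hG⟩ := hone c hc
    exact isRegularLocalRing_localization_blowupAlgebra_chartRing K F hF c e R ρ' hρ₁ hρ₂ hc _ rfl hrad Φ Ψ hΦ hΦ0 hΨ hρf hG a 𝔐 h𝔐
  · -- off the centre: the blow-up is a local isomorphism onto a regular chart
    haveI := hπ.isIso_stalkMap_of_not_mem_support hzs
    have hι : (hypersurfaceι F).left (π z) ∉ ((Proj.map fk hfk').ker.support : Set (Proj (homogeneousSubmodule (Fin (m + 2 + 1)) K))) := by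
      intro h
      apply hzs
      rw [Scheme.IdealSheafData.support_comap]
      exact h
    obtain ⟨a, ha, hXa'⟩ := LinearCentre.exists_X_not_mem_of_not_mem_support e he fk hfk' hfkC hfke hfk0 hι
    haveI := OrdPoint.isRegularLocalRing_stalk_of_chartRing K F hF hd a (hoff a ha) (π z) ((Proj.mem_basicOpen _ _ _).mpr hXa')
    exact IsRegularLocalRing.of_ringEquiv (R := (hypersurface F).left.presheaf.stalk (π z)) (asIso (π.stalkMap z)).commRingCatIsoToRingEquiv

include hF hFp in
/-- **`Λ·𝒪_H ≠ ⊥`** when some killed `x_a ∉ (F)` (`H ⊄ L`: ✓ `not_range_subset_support`). [folklore] -/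
theorem comap_ne_bot {a : Fin (m + 2 + 1)} (ha : a ∉ Set.range e) (hXa : (X a : MvPolynomial (Fin (m + 2 + 1)) K) ∉ Ideal.span {F}) :
    letI := MvPolynomial.gradedAlgebra (σ := Fin (m + 2 + 1)) (R := K)
    letI := MvPolynomial.gradedAlgebra (σ := Fin (r + 1)) (R := K)
    ∀ (fk : homogeneousSubmodule (Fin (m + 2 + 1)) K →+*ᵍ homogeneousSubmodule (Fin (r + 1)) K)
      (hfk' : HomogeneousIdeal.irrelevant (homogeneousSubmodule (Fin (r + 1)) K) ≤
        (HomogeneousIdeal.irrelevant (homogeneousSubmodule (Fin (m + 2 + 1)) K)).map fk)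
      (_hfkC : ∀ a : K, fk (C a) = C a) (_hfke : ∀ j : Fin (r + 1), fk (X (e j)) = X j)
      (_hfk0 : ∀ i : Fin (m + 2 + 1), i ∉ Set.range e → fk (X i) = 0),
      (((Proj.map fk hfk').ker).comap (hypersurfaceι F).left) ≠ ⊥ := by
  letI := MvPolynomial.gradedAlgebra (σ := Fin (m + 2 + 1)) (R := K)
  letI := MvPolynomial.gradedAlgebra (σ := Fin (r + 1)) (R := K)
  intro fk hfk' hfkC hfke hfk0 h0
  apply not_range_subset_support K F hF e fk hfk' hfkC hfke hfk0 hFp ha hXa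
  rintro _ ⟨x, rfl⟩
  have hxs : x ∈ ((((Proj.map fk hfk').ker).comap (hypersurfaceι F).left).support : Set (hypersurface F).left) := by
    rw [h0, Scheme.IdealSheafData.support_bot]; trivial
  rw [Scheme.IdealSheafData.support_comap] at hxs
  exact hxs

end OneStepLine

end Summit.ResolutionOfSingularities.ResolutionOfSingularities.Cruxes.EquisingularLiftNat.Sections

namespace Summit.ResolutionOfSingularities.ResolutionOfSingularities.Cruxes.EquisingularLift.StrataSplit

open Summit.ResolutionOfSingularities.ResolutionOfSingularities.Cruxes.EquisingularLiftNat.Sections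
open Summit.ResolutionOfSingularities.ResolutionOfSingularities.Cruxes.EquisingularLiftNat

/-- ★ **Hypersurfaces whose singular locus is a ONE-STEP coordinate `ℙʳ` have regular blow-up models — every field, every dimension** (hypotheses of
✓ `OneStepLine.elNatAt_oneStepLine` minus algebraic closure / characteristic and minus `L ⊆ H`, which only the E1 clause upstairs needs): `V₊(F)` carries a non-zero ideal sheaf (the trace of the `ℙʳ`) all of whose
blow-ups are regular (`OneStepLine.isRegular_of_isBlowup_comap`, `OneStepLine.comap_ne_bot`). [cite: Hartshorne1977, II Ex. 7.12] [cite: StacksProject, Tag 0804] -/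
theorem blowupModel_oneStepLine (K : Type) [Field K] {m : ℕ} (F : MvPolynomial (Fin (m + 2 + 1)) K) {d : ℕ} (hF : F.IsHomogeneous d)
    (hFp : Prime F) {r : ℕ} (e : Fin (r + 1) → Fin (m + 2 + 1)) (he : Function.Injective e)
    (hXa : ∃ a, a ∉ Set.range e ∧ (X a : MvPolynomial (Fin (m + 2 + 1)) K) ∉ Ideal.span {F})
    (hoff : letI := MvPolynomial.gradedAlgebra (σ := Fin (m + 2 + 1)) (R := K)
      ∀ c, c ∉ Set.range e → IsRegularRing (ChartRing F c hF))
    (hone : ∀ c ∈ Set.range e, ∃ (M : ℕ) (R : Type) (_ : CommRing R) (_ : IsDomain R)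
      (ρ : MvPolynomial (Fin (m + 2)) K ≃+* MvPolynomial (Fin (M + 1)) R),
      (∀ j : Fin (m + 2), c.succAbove j ∉ Set.range e → ∃ i : Fin (M + 1), ρ (X j) = X i) ∧
      (∀ i : Fin (M + 1), ∃ j : Fin (m + 2), c.succAbove j ∉ Set.range e ∧ ρ (X j) = X i) ∧
      ∃ (Φ Ψ : MvPolynomial (Fin (M + 1)) R) (μ : ℕ), Φ.IsHomogeneous μ ∧ Φ ≠ 0 ∧
        Ψ ∈ Ideal.span (Set.range (X : Fin (M + 1) → MvPolynomial (Fin (M + 1)) R)) ^ (μ + 1) ∧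
        ρ (ProjectiveSpace.dehomogenize K c F) = Φ + Ψ ∧
        (Ideal.span {ProjectiveSpace.dehomogenize K c F}).radical = Ideal.span {ProjectiveSpace.dehomogenize K c F} ∧
        ∀ l : Fin (M + 1), ∃ G : MvPolynomial (Fin (M + 1)) R,
          aeval (fun j => X l * Function.update (X : Fin (M + 1) → MvPolynomial (Fin (M + 1)) R) l 1 j) (Φ + Ψ) = X l ^ μ * G ∧
          ∀ (P : Ideal (MvPolynomial (Fin (M + 1)) R ⧸ Ideal.span {G})) [P.IsPrime],
            Ideal.Quotient.mk (Ideal.span {G}) (X l) ∈ P → IsRegularLocalRing (Localization.AtPrime P)) :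
    letI := MvPolynomial.gradedAlgebra (σ := Fin (m + 2 + 1)) (R := K)
    ∃ 𝔞 : (hypersurface F).left.IdealSheafData, 𝔞 ≠ ⊥ ∧
      ∀ (Z : Scheme.{0}) (π : Z ⟶ (hypersurface F).left), IsBlowup π 𝔞 → Scheme.IsRegular Z := by
  letI := MvPolynomial.gradedAlgebra (σ := Fin (m + 2 + 1)) (R := K)
  letI := MvPolynomial.gradedAlgebra (σ := Fin (r + 1)) (R := K)
  obtain ⟨fk, hfk', hfkC, hfke, hfk0⟩ := Summit.ResolutionOfSingularities.ResolutionOfSingularities.Cruxes.EquisingularLiftNat.LinearCentre.exists_kill (R := K) e he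
  obtain ⟨a₀, ha₀, hXa₀⟩ := hXa
  exact ⟨_, OneStepLine.comap_ne_bot K F hF hFp e ha₀ hXa₀ fk hfk' hfkC hfke hfk0,
    fun Z π hπ => OneStepLine.isRegular_of_isBlowup_comap K F hF hFp e he hone hoff fk hfk' hfkC hfke hfk0 Z π hπ⟩

/-- ★ **Hypersurfaces whose singular locus is a FIRST-ORDER coordinate `ℙʳ` have regular blow-up models — every field, every dimension** (hypotheses of
✓ `FirstOrderLine.elNatAt_firstOrderLine` minus algebraic closure / characteristic; the strict transforms from ✓ `FirstOrderLine.exists_strictTransform`).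
[cite: Hartshorne1977, II Ex. 7.12] [cite: StacksProject, Tag 0804] -/
theorem blowupModel_firstOrderLine (K : Type) [Field K] {m : ℕ} (F : MvPolynomial (Fin (m + 2 + 1)) K) {d : ℕ} (hF : F.IsHomogeneous d)
    (hFp : Prime F) {r : ℕ} (e : Fin (r + 1) → Fin (m + 2 + 1)) (he : Function.Injective e)
    (hXa : ∃ a, a ∉ Set.range e ∧ (X a : MvPolynomial (Fin (m + 2 + 1)) K) ∉ Ideal.span {F})
    (hoff : letI := MvPolynomial.gradedAlgebra (σ := Fin (m + 2 + 1)) (R := K)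
      ∀ c, c ∉ Set.range e → IsRegularRing (ChartRing F c hF))
    (hfo : ∀ c ∈ Set.range e, ∃ (M : ℕ) (R : Type) (_ : CommRing R) (_ : IsDomain R)
      (σ : MvPolynomial (Fin (m + 2)) K ≃+* MvPolynomial (Fin (M + 1)) R),
      (∀ j : Fin (m + 2), c.succAbove j ∉ Set.range e → ∃ i : Fin (M + 1), σ (X j) = X i) ∧
      (∀ i : Fin (M + 1), ∃ j : Fin (m + 2), c.succAbove j ∉ Set.range e ∧ σ (X j) = X i) ∧
      ∃ (Φ Ψ₁ Ψ' : MvPolynomial (Fin (M + 1)) R) (μ : ℕ), Φ.IsHomogeneous μ ∧ Φ ≠ 0 ∧ Ψ₁.IsHomogeneous (μ + 1) ∧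
        Ψ' ∈ Ideal.span (Set.range (X : Fin (M + 1) → MvPolynomial (Fin (M + 1)) R)) ^ (μ + 2) ∧
        σ (ProjectiveSpace.dehomogenize K c F) = Φ + (Ψ₁ + Ψ') ∧
        ∃ (ι : Type) (_ : Finite ι) (ρ : MvPolynomial ι K ≃+* MvPolynomial (Fin (M + 1)) R) (ιz : Fin (M + 1) → ι),
          (∀ (j : Fin (M + 1)) (q : MvPolynomial (Fin (M + 1)) R), ρ (pderiv (ιz j) (ρ.symm q)) = pderiv j q) ∧
          (∀ v, v ∉ Set.range ιz → ∀ j : Fin (M + 1), ρ (pderiv v (ρ.symm (X j))) = 0) ∧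
          (∀ v, v ∉ Set.range ιz → ∀ a : R, ∃ a' : R, ρ (pderiv v (ρ.symm (C a))) = C a') ∧
          ∀ P : Ideal (MvPolynomial (Fin (M + 1)) R), P.IsPrime → Φ ∈ P → (∀ v : ι, ρ (pderiv v (ρ.symm Φ)) ∈ P) → Ψ₁ ∈ P →
            ∀ j, (X j : MvPolynomial (Fin (M + 1)) R) ∈ P) :
    letI := MvPolynomial.gradedAlgebra (σ := Fin (m + 2 + 1)) (R := K)
    ∃ 𝔞 : (hypersurface F).left.IdealSheafData, 𝔞 ≠ ⊥ ∧
      ∀ (Z : Scheme.{0}) (π : Z ⟶ (hypersurface F).left), IsBlowup π 𝔞 → Scheme.IsRegular Z := by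
  refine blowupModel_oneStepLine K F hF hFp e he hXa hoff fun c hc => ?_
  obtain ⟨M, R, _, _, σ, hσ₁, hσ₂, Φ, Ψ₁, Ψ', μ, hΦ, hΦ0, hΨ₁, hΨ', hdeh, ι, _, ρ, ιz, hDz, hDuX, hDuC, hcrit⟩ := hfo c hc
  refine ⟨M, R, inferInstance, inferInstance, σ, hσ₁, hσ₂, Φ, Ψ₁ + Ψ', μ, hΦ, hΦ0, ?_, hdeh,
    MultiOrd.radical_span_dehomogenize_eq_of_prime F hF hFp c, fun l => ?_⟩
  · refine Ideal.add_mem _ ?_ (Ideal.pow_le_pow_right (by omega) hΨ')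
    change Ψ₁ ∈ MvPolynomial.idealOfVars (Fin (M + 1)) R ^ (μ + 1)
    refine (MvPolynomial.mem_pow_idealOfVars_iff (μ + 1) Ψ₁).mpr fun d hd => ?_
    have h := hΨ₁ (mem_support_iff.mp hd)
    rw [Finsupp.degree_eq_weight_one]
    exact h.symm.le
  · obtain ⟨G, hG, hreg⟩ := FirstOrderLine.exists_strictTransform ρ ιz hDz hDuX hDuC Φ Ψ₁ Ψ' hΦ hΨ₁ hΨ' hcrit l
    exact ⟨G, hG, fun P _ hP => hreg P hP⟩

end Summit.ResolutionOfSingularities.ResolutionOfSingularities.Cruxes.EquisingularLift.StrataSplit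

end
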